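import Literature.AlgebraicGeometry.Motives.MixedHodgeStructureInternalHomUnit
import HarnessLib

/-!
# The internal adjunction `Hom(H₁ ⊗ H₂, H₃) ≅ Hom(H₁, Hom(H₂, H₃))` and `(H₁ ⊗ H₂)^∨ ≅ H₁^∨ ⊗ H₂^∨`

For mixed `ℚ`-Hodge structures on finite-dimensional spaces, currying
`Hom(V ⊗ V', V'') ≅ Hom(V, Hom(V', V''))` (Mathlib's `TensorProduct.lift.equiv`) is an isomorphism of
mixed Hodge structures between the internal Homs (Deligne–Milne, *Tannakian categories*, §1
(1.6.3): "an isomorphism `Hom(Z, Hom(X, Y)) ≅ Hom(Z ⊗ X, Y)`" of internal Homs; Deligne, *Hodge II*,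
1.1.12: the filtrations on iterated `Hom`/`⊗` are "compatibles à la composition des foncteurs"):
by the pointwise description of the filtrations of the internal Hom
(`Motives/MixedHodgeStructureInternalHomFiltrations`), `f ∈ W_r Hom(H₁ ⊗ H₂, H₃)` iff
`f(W_i ⊗ W_j) ⊆ W_{i+j+r}` for all `i, j` iff `curry f ∈ W_r Hom(H₁, Hom(H₂, H₃))`, and likewise for
`F` after complexification.  With `Hom(−, ℚ(0)) = (−)^∨` (`hom_unit_eq_dual`,
`Motives/MixedHodgeStructureInternalHomUnit`) and `Hom(H₁, H₂^∨) ≅ H₁^∨ ⊗ H₂^∨` (`homToTensor`,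
`Motives/MixedHodgeStructureInternalHom`) this gives the isomorphism of MHS
**`(H₁ ⊗ H₂)^∨ ≅ H₁^∨ ⊗ H₂^∨`**, inverse to Mathlib's `TensorProduct.dualDistrib`
(`f ⊗ g ↦ (v ⊗ w ↦ f(v) g(w))`; El Zein–Lê, Ch. 3 of Cattani–El Zein–Griffiths–Lê, §3.2.2.7: duals and
tensor products of MHS "by applying the general rules of filtrations").

## Main results (definitions with bodies and theorems; no named facts)

* `Hom.ofEq` — the identity as a morphism `H → H'` for equal structures `H = H'` (plumbing);
* **`homTensorCurry : Hom (Hom(H₁ ⊗ H₂, H₃)) (Hom(H₁, Hom(H₂, H₃)))`**, `homTensorCurry_bijective`,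
  **`homTensorUncurry`** (inverse), `hodgeNumber_hom_tensor_eq`;
* **`tensorDualHom : Hom ((H₁ ⊗ H₂)^∨) (H₁^∨ ⊗ H₂^∨)`**, `tensorDualHom_toLinearMap_dualDistrib`
  (it inverts `dualDistrib`), `tensorDualHom_bijective`, **`dualDistribHom`** (inverse, underlying map
  `TensorProduct.dualDistrib`), `hodgeNumber_dual_tensor`.

## References

* [DeligneMilne1982Tannakian] P. Deligne, J. S. Milne, Tannakian categories, LNM 900, §1 (1.6.3),
  (1.6.4) (held text `book:deligne1982-hodge-cycles-motives-shimura-varieties`, p. 84).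
* [DeligneHodgeII1971] P. Deligne, Théorie de Hodge II, 1.1.6, 1.1.12.
* [CattaniElZeinGriffithsLe2014] E. Cattani et al. (eds.), Hodge Theory (2014), Ch. 3 §3.2.2.7,
  Thm. 3.2.18.
-/

noncomputable section

open scoped TensorProduct

namespace Literature.AlgebraicGeometry.Motives

namespace MixedHodgeStructure

universe u v w

variable {V : Type u} [AddCommGroup V] [Module ℚ V]
variable {V' : Type v} [AddCommGroup V'] [Module ℚ V']
variable {V'' : Type w} [AddCommGroup V''] [Module ℚ V'']

open Module
open HodgeStructure (homBaseChange homBaseChange_tmul tensorBaseChange tensorBaseChange_tmul)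

/-! ### Plumbing -/

/-- The identity map as a morphism between two EQUAL mixed Hodge structures on the same space.
[folklore] -/
def Hom.ofEq {H H' : MixedHodgeStructure V} (h : H = H') : Hom H H' where
  toLinearMap := LinearMap.id
  map_W_le k := by subst h; simp
  map_F_le p := by subst h; simp [LinearMap.baseChange_id]

/-- The underlying map of `Hom.ofEq` is the identity (by `rfl`). [folklore] -/
private theorem Hom.ofEq_toLinearMap {H H' : MixedHodgeStructure V} (h : H = H') :
    (Hom.ofEq h).toLinearMap = LinearMap.id :=
  rfl

/-- `tensorBaseChange⁻¹ ((c ⊗ v) ⊗ (d ⊗ w)) = (c d) ⊗ (v ⊗ w)`. [folklore] -/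
private theorem tensorBaseChange_symm_tmul_tmul (c d : ℂ) (a : V) (b : V') :
    (tensorBaseChange V V').symm ((c ⊗ₜ[ℚ] a) ⊗ₜ[ℂ] (d ⊗ₜ[ℚ] b)) = (c * d) ⊗ₜ[ℚ] (a ⊗ₜ[ℚ] b) := by
  rw [LinearEquiv.symm_apply_eq, tensorBaseChange_tmul,
    show (d ⊗ₜ[ℚ] b : ℂ ⊗[ℚ] V') = d • ((1 : ℂ) ⊗ₜ[ℚ] b) by
      rw [TensorProduct.smul_tmul', smul_eq_mul, mul_one],
    TensorProduct.tmul_smul, TensorProduct.smul_tmul', TensorProduct.smul_tmul', smul_eq_mul, mul_comm]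

/-- Currying `Hom(V ⊗ V', V'') → Hom(V, Hom(V', V''))` as a `ℚ`-linear map (Mathlib's
`TensorProduct.lift.equiv` reversed). [folklore] -/
private def curryLin (V : Type u) (V' : Type v) (V'' : Type w) [AddCommGroup V] [Module ℚ V]
    [AddCommGroup V'] [Module ℚ V'] [AddCommGroup V''] [Module ℚ V''] :
    (V ⊗[ℚ] V' →ₗ[ℚ] V'') →ₗ[ℚ] V →ₗ[ℚ] V' →ₗ[ℚ] V'' :=
  ((TensorProduct.lift.equiv (RingHom.id ℚ) V V' V'').symm :
    (V ⊗[ℚ] V' →ₗ[ℚ] V'') →ₗ[ℚ] V →ₗ[ℚ] V' →ₗ[ℚ] V'')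

/-- `curryLin f v v' = f (v ⊗ v')`. [folklore] -/
private theorem curryLin_apply (f : V ⊗[ℚ] V' →ₗ[ℚ] V'') (v : V) (v' : V') :
    curryLin V V' V'' f v v' = f (v ⊗ₜ[ℚ] v') :=
  rfl

/-- Comparison: `hBC(hBC((curry)_ℂ ξ) τ) y = hBC ξ (tBC⁻¹ (τ ⊗ y))` (on `ξ = c₀ ⊗ f`, `τ = c ⊗ v`,
`y = d ⊗ v'` both sides are `(c₀ c d) ⊗ f(v ⊗ v')`). [folklore] -/
private theorem homBaseChange_homBaseChange_curry (ξ : ℂ ⊗[ℚ] (V ⊗[ℚ] V' →ₗ[ℚ] V''))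
    (τ : ℂ ⊗[ℚ] V) (y : ℂ ⊗[ℚ] V') :
    homBaseChange V' V'' (homBaseChange V (V' →ₗ[ℚ] V'') ((curryLin V V' V'').baseChange ℂ ξ) τ) y =
      homBaseChange (V ⊗[ℚ] V') V'' ξ ((tensorBaseChange V V').symm (τ ⊗ₜ[ℂ] y)) := by
  induction ξ using TensorProduct.induction_on with
  | zero => simp only [map_zero, LinearMap.zero_apply]
  | add ξ₁ ξ₂ h₁ h₂ => simp only [map_add, LinearMap.add_apply, h₁, h₂]
  | tmul c₀ f =>
    induction τ using TensorProduct.induction_on with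
    | zero => simp only [map_zero, LinearMap.zero_apply, TensorProduct.zero_tmul]
    | add τ₁ τ₂ h₁ h₂ => simp only [map_add, LinearMap.add_apply, TensorProduct.add_tmul, h₁, h₂]
    | tmul c v =>
      induction y using TensorProduct.induction_on with
      | zero => simp only [map_zero, TensorProduct.tmul_zero]
      | add y₁ y₂ h₁ h₂ => simp only [map_add, TensorProduct.tmul_add, h₁, h₂]
      | tmul d v' =>
        rw [LinearMap.baseChange_tmul, homBaseChange_tmul, LinearMap.smul_apply, LinearMap.baseChange_tmul,
          TensorProduct.smul_tmul', smul_eq_mul, homBaseChange_tmul, LinearMap.smul_apply,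
          LinearMap.baseChange_tmul, curryLin_apply, TensorProduct.smul_tmul', smul_eq_mul,
          tensorBaseChange_symm_tmul_tmul, homBaseChange_tmul, LinearMap.smul_apply, LinearMap.baseChange_tmul,
          TensorProduct.smul_tmul', smul_eq_mul, mul_assoc]

variable [FiniteDimensional ℚ V] [FiniteDimensional ℚ V'] [FiniteDimensional ℚ V'']
  (H₁ : MixedHodgeStructure V) (H₂ : MixedHodgeStructure V') (H₃ : MixedHodgeStructure V'')

/-! ### Currying is an isomorphism of the internal Homs -/

/-- **Currying `Hom(H₁ ⊗ H₂, H₃) → Hom(H₁, Hom(H₂, H₃))`, `f ↦ (v ↦ (v' ↦ f(v ⊗ v')))`, is a morphism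
of mixed Hodge structures** between the internal Homs: `f ∈ W_r Hom(H₁ ⊗ H₂, H₃)`, i.e.
`f(Σ_{i+j=n} W_i ⊗ W_j) ⊆ W_{n+r}` for all `n`, gives `f(v ⊗ W_j) ⊆ W_{j+i+r}` for `v ∈ W_i`, i.e.
`curry f ∈ W_r Hom(H₁, Hom(H₂, H₃))` (`mem_hom_W_iff` twice); likewise for `F`, through the comparison
`hBC(hBC((curry)_ℂ ξ) τ) y = hBC ξ (τ ⊗ y)` (Deligne–Milne (1.6.3); Deligne, Hodge II, 1.1.12).
[cite: DeligneMilne1982Tannakian, §1 (1.6.3)] [cite: DeligneHodgeII1971, 1.1.12] -/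
def homTensorCurry : Hom (hom (tensor H₁ H₂) H₃) (hom H₁ (hom H₂ H₃)) where
  toLinearMap := curryLin V V' V''
  map_W_le r := by
    rintro _ ⟨f, hf, rfl⟩
    rw [SetLike.mem_coe, mem_hom_W_iff] at hf
    rw [mem_hom_W_iff]
    rintro i _ ⟨v, hv, rfl⟩
    rw [mem_hom_W_iff]
    rintro j _ ⟨v', hv', rfl⟩
    rw [curryLin_apply]
    refine H₃.monotone_W (show (i + j) + r ≤ j + (i + r) by omega) (hf (i + j) ⟨v ⊗ₜ v', ?_, rfl⟩)
    rw [tensor_W]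
    exact Submodule.mem_iSup_of_mem (i, j) (Submodule.mem_iSup_of_mem rfl (Submodule.apply_mem_map₂ _ hv hv'))
  map_F_le p := by
    rintro _ ⟨ξ, hξ, rfl⟩
    rw [SetLike.mem_coe, mem_hom_F_iff] at hξ
    rw [mem_hom_F_iff]
    rintro a _ ⟨τ, hτ, rfl⟩
    rw [mem_hom_F_iff]
    rintro c _ ⟨y, hy, rfl⟩
    rw [homBaseChange_homBaseChange_curry]
    refine H₃.antitone_F (show c + (a + p) ≤ (a + c) + p by omega) (hξ (a + c) ⟨_, ?_, rfl⟩)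
    rw [tensor_F]
    refine Submodule.mem_iSup_of_mem (a, c) (Submodule.mem_iSup_of_mem rfl ?_)
    rw [Submodule.mem_comap, LinearEquiv.coe_coe, LinearEquiv.apply_symm_apply]
    exact Submodule.apply_mem_map₂ _ hτ hy

/-- The underlying map of `homTensorCurry`: `(curry f) v v' = f(v ⊗ v')`.
[cite: DeligneMilne1982Tannakian, §1 (1.6.3)] -/
@[simp]
theorem homTensorCurry_toLinearMap_apply (f : V ⊗[ℚ] V' →ₗ[ℚ] V'') (v : V) (v' : V') :
    (homTensorCurry H₁ H₂ H₃).toLinearMap f v v' = f (v ⊗ₜ[ℚ] v') :=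
  rfl

/-- `homTensorCurry` is bijective (Mathlib's `TensorProduct.lift.equiv`).
[cite: DeligneMilne1982Tannakian, §1 (1.6.3)] -/
theorem homTensorCurry_bijective : Function.Bijective (homTensorCurry H₁ H₂ H₃).toLinearMap :=
  (TensorProduct.lift.equiv (RingHom.id ℚ) V V' V'').symm.bijective

/-- **Uncurrying `Hom(H₁, Hom(H₂, H₃)) → Hom(H₁ ⊗ H₂, H₃)` is a morphism of mixed Hodge structures**
(the inverse of the bijective morphism `homTensorCurry`; strictness, El Zein–Lê Thm. 3.2.18 — the
tree's `Hom.inverse`), so `Hom(H₁ ⊗ H₂, H₃) ≅ Hom(H₁, Hom(H₂, H₃))` as MHS.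
[cite: DeligneMilne1982Tannakian, §1 (1.6.3)] [cite: CattaniElZeinGriffithsLe2014, Thm. 3.2.18] -/
def homTensorUncurry : Hom (hom H₁ (hom H₂ H₃)) (hom (tensor H₁ H₂) H₃) :=
  (homTensorCurry H₁ H₂ H₃).inverse (homTensorCurry_bijective H₁ H₂ H₃)

/-- `homTensorUncurry ∘ homTensorCurry = id`. [cite: DeligneMilne1982Tannakian, §1 (1.6.3)] -/
theorem homTensorUncurry_comp_homTensorCurry :
    (homTensorUncurry H₁ H₂ H₃).comp (homTensorCurry H₁ H₂ H₃) = Hom.id _ :=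
  Hom.inverse_comp _ _

/-- `homTensorCurry ∘ homTensorUncurry = id`. [cite: DeligneMilne1982Tannakian, §1 (1.6.3)] -/
theorem homTensorCurry_comp_homTensorUncurry :
    (homTensorCurry H₁ H₂ H₃).comp (homTensorUncurry H₁ H₂ H₃) = Hom.id _ :=
  Hom.comp_inverse _ _

/-- The underlying map of `homTensorUncurry`: `(uncurry g)(v ⊗ v') = g v v'`.
[cite: DeligneMilne1982Tannakian, §1 (1.6.3)] -/
theorem homTensorUncurry_toLinearMap_apply_tmul (g : V →ₗ[ℚ] V' →ₗ[ℚ] V'') (v : V) (v' : V') :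
    (homTensorUncurry H₁ H₂ H₃).toLinearMap g (v ⊗ₜ[ℚ] v') = g v v' := by
  rw [homTensorUncurry, Hom.inverse_toLinearMap]
  have h : (LinearEquiv.ofBijective (homTensorCurry H₁ H₂ H₃).toLinearMap
      (homTensorCurry_bijective H₁ H₂ H₃)).symm g = TensorProduct.lift g := by
    rw [LinearEquiv.symm_apply_eq]
    refine LinearMap.ext fun x ↦ LinearMap.ext fun x' ↦ ?_
    rw [LinearEquiv.ofBijective_apply, homTensorCurry_toLinearMap_apply, TensorProduct.lift.tmul]
  rw [LinearEquiv.coe_coe, h, TensorProduct.lift.tmul]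

/-- **`h^{p,q}(Hom(H₁ ⊗ H₂, H₃)) = h^{p,q}(Hom(H₁, Hom(H₂, H₃)))`.** [cite: DeligneMilne1982Tannakian, §1 (1.6.3)] -/
theorem hodgeNumber_hom_tensor_eq (p q : ℤ) :
    (hom (tensor H₁ H₂) H₃).hodgeNumber p q = (hom H₁ (hom H₂ H₃)).hodgeNumber p q :=
  Hom.hodgeNumber_eq_of_bijective (homTensorCurry H₁ H₂ H₃) (homTensorCurry_bijective H₁ H₂ H₃) p q

/-! ### `(H₁ ⊗ H₂)^∨ ≅ H₁^∨ ⊗ H₂^∨` -/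

/-- **The isomorphism of MHS `(H₁ ⊗ H₂)^∨ → H₁^∨ ⊗ H₂^∨`**: the composite
`(H₁ ⊗ H₂)^∨ = Hom(H₁ ⊗ H₂, ℚ(0)) —curry→ Hom(H₁, Hom(H₂, ℚ(0))) = Hom(H₁, H₂^∨) ≅ H₁^∨ ⊗ H₂^∨`
(`hom_unit_eq_dual`, `homTensorCurry`, `homToTensor`); underlying map
`φ ↦ (V^∨ ⊗ V'^∨ ≅ Hom(V, V'^∨))⁻¹ (v ↦ φ(v ⊗ ·))`, the inverse of Mathlib's `TensorProduct.dualDistrib`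
(`tensorDualHom_toLinearMap_dualDistrib`). El Zein–Lê §3.2.2.7: duals and tensor products of MHS by "the
general rules of filtrations" (Deligne, Hodge II, 1.1.6, 1.1.12). [cite: CattaniElZeinGriffithsLe2014, Ch. 3 §3.2.2.7 p. 163]
[cite: DeligneHodgeII1971, 1.1.6 and 1.1.12] -/
def tensorDualHom : Hom (tensor H₁ H₂).dual (tensor H₁.dual H₂.dual) :=
  (homToTensor H₁ H₂.dual).comp ((Hom.ofEq (congrArg (hom H₁) (hom_unit_eq_dual H₂))).comp
    ((homTensorCurry H₁ H₂ (HodgeStructure.tate 0).toMixedHodgeStructure).comp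
      (Hom.ofEq (hom_unit_eq_dual (tensor H₁ H₂)).symm)))

/-- **`tensorDualHom` inverts `dualDistrib`**: the class of `v ⊗ w ↦ f(v) g(w)` is sent to `f ⊗ g`.
[cite: CattaniElZeinGriffithsLe2014, Ch. 3 §3.2.2.7 p. 163] -/
theorem tensorDualHom_toLinearMap_dualDistrib (f : Module.Dual ℚ V) (g : Module.Dual ℚ V') :
    (tensorDualHom H₁ H₂).toLinearMap (TensorProduct.dualDistrib ℚ V V' (f ⊗ₜ[ℚ] g)) = f ⊗ₜ[ℚ] g := by
  rw [tensorDualHom, Hom.comp_toLinearMap, Hom.comp_toLinearMap, Hom.comp_toLinearMap, Hom.ofEq_toLinearMap,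
    Hom.ofEq_toLinearMap, LinearMap.id_comp, LinearMap.comp_id, LinearMap.comp_apply, homToTensor_toLinearMap,
    LinearEquiv.coe_coe, LinearEquiv.symm_apply_eq]
  have happ : ∀ y, dualTensorHomEquiv ℚ V (Module.Dual ℚ V') y = dualTensorHom ℚ V (Module.Dual ℚ V') y :=
    fun y ↦ by rw [dualTensorHomEquiv, dualTensorHomEquivOfBasis_apply]
  rw [happ]
  refine LinearMap.ext fun v ↦ LinearMap.ext fun w ↦ ?_
  rw [homTensorCurry_toLinearMap_apply, TensorProduct.dualDistrib_apply, dualTensorHom_apply,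
    LinearMap.smul_apply, smul_eq_mul]

/-- `tensorDualHom` is bijective. [cite: CattaniElZeinGriffithsLe2014, Ch. 3 §3.2.2.7 and Thm. 3.2.18] -/
theorem tensorDualHom_bijective : Function.Bijective (tensorDualHom H₁ H₂).toLinearMap := by
  rw [tensorDualHom, Hom.comp_toLinearMap, Hom.comp_toLinearMap, Hom.comp_toLinearMap, Hom.ofEq_toLinearMap,
    Hom.ofEq_toLinearMap, LinearMap.id_comp, LinearMap.comp_id, LinearMap.coe_comp]
  exact (homToTensor_bijective H₁ H₂.dual).comp (homTensorCurry_bijective H₁ H₂ _)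

/-- **The isomorphism of MHS `H₁^∨ ⊗ H₂^∨ → (H₁ ⊗ H₂)^∨`, `f ⊗ g ↦ (v ⊗ w ↦ f(v) g(w))`** (inverse of
`tensorDualHom`; a morphism by strictness, `Hom.inverse`). [cite: CattaniElZeinGriffithsLe2014, Ch. 3 §3.2.2.7 and Thm. 3.2.18] -/
def dualDistribHom : Hom (tensor H₁.dual H₂.dual) (tensor H₁ H₂).dual :=
  (tensorDualHom H₁ H₂).inverse (tensorDualHom_bijective H₁ H₂)

/-- **The underlying map of `dualDistribHom` is Mathlib's `TensorProduct.dualDistrib`.**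
[cite: CattaniElZeinGriffithsLe2014, Ch. 3 §3.2.2.7 p. 163] -/
theorem dualDistribHom_toLinearMap :
    (dualDistribHom H₁ H₂).toLinearMap = TensorProduct.dualDistrib ℚ V V' := by
  refine TensorProduct.ext' fun f g ↦ ?_
  rw [dualDistribHom, Hom.inverse_toLinearMap, LinearEquiv.coe_coe, LinearEquiv.symm_apply_eq,
    LinearEquiv.ofBijective_apply, tensorDualHom_toLinearMap_dualDistrib]

/-- `dualDistribHom ∘ tensorDualHom = id`. [cite: CattaniElZeinGriffithsLe2014, Thm. 3.2.18] -/
theorem dualDistribHom_comp_tensorDualHom :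
    (dualDistribHom H₁ H₂).comp (tensorDualHom H₁ H₂) = Hom.id _ :=
  Hom.inverse_comp _ _

/-- `tensorDualHom ∘ dualDistribHom = id`. [cite: CattaniElZeinGriffithsLe2014, Thm. 3.2.18] -/
theorem tensorDualHom_comp_dualDistribHom :
    (tensorDualHom H₁ H₂).comp (dualDistribHom H₁ H₂) = Hom.id _ :=
  Hom.comp_inverse _ _

/-- **`h^{p,q}((H₁ ⊗ H₂)^∨) = h^{p,q}(H₁^∨ ⊗ H₂^∨)`.** [cite: CattaniElZeinGriffithsLe2014, Ch. 3 §3.2.2.7 p. 163] -/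
theorem hodgeNumber_dual_tensor (p q : ℤ) :
    (tensor H₁ H₂).dual.hodgeNumber p q = (tensor H₁.dual H₂.dual).hodgeNumber p q :=
  Hom.hodgeNumber_eq_of_bijective (tensorDualHom H₁ H₂) (tensorDualHom_bijective H₁ H₂) p q

end MixedHodgeStructure

end Literature.AlgebraicGeometry.Motives

end
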